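import Summits.QuantumFields.BalabanUV.T4Continuum.Support.LateMergersBanking

/-!
# Balaban T⁴ spine, estimate NE7b (node U5c, COUNT member P1): LATE MERGERS WITH AN OVERDUE PARTNER under [CONV-D]
# — part 4 of 4: the bridge from a span inequality, the seam, and END TO END over the canonical menus

Cell `pub-balaban`, lineage `b2b-balaban-t4-ne7b-p1` (generation 17), self-row `T4-U5c.E-NE7b-LATEMERGE-K*`, residual
(H1) of GAPS G-ne7bp1g16-1; Summits-side NEW WORK under the LEAN PLACEMENT RULE 2026-08-19 (cell bookkeeping, print
quoted for CONTEXT only); same namespace as parts 1–3; imports part 3 (`…Support.LateMergersBanking`) ONLY.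

HONEST FRAMING.  Rung (B)+1 of the FINITE-VOLUME T⁴ continuum programme: bookkeeping over the lineage's OWN typed
ledger of persistent large-field histories (`T4PersistenceDictionary.Gen`, `T4TaggedShapeBanking`, `T4CountHorizon`).
NOT infinite volume, NOT a mass gap, NOT the Clay problem, NOT a proof of NE7b; nothing of Bałaban's expansion is
asserted; `BetaPertH` / (B) / (B^μ) are not involved (upstream of the term families, displayed by name elsewhere).
HONEST DEPENDENCY (cell, verbatim): continuum YM on T⁴ ⇐ BetaPertH ∧ nine spine estimates (0/9 proved); BetaPertH ⇐
(D1) ∧ (D4) ∧ CAP+tail; G-an2-4 gates asym, D1 and NE2/3/4.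

CONTENT (part 4; every declaration [folklore], sorry-free, standard axioms).  §9 `treeShape_of_spanLE`: the bridge
`T4BranchingRecordsGas.treeShape_of_mulRawShape` re-proved from ONE displayed span inequality `(N − rootStep) +
partnerAges ≤ Σ_{events} W e` for an arbitrary BANK table `W` (well-formedness for any other table is used only for label
distinctness); `rawFactor_le_shapeTH` = `T4BankedInduction.rawFactor_le_recordPrice` by name for the late-merger
banking; the SEAM `treeShape_of_labelBTH` / `treeShape_of_labelTH`: a price either `≤ 0` or at most `Δ·Λ′^{partnerAges}`
× the raw factor (PADDED life cost) of a `ConsistentTH`, `FreshT` tagged genealogy with `K − D < reach` obeys the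
conclusion of `T4CountHorizon.treeShape_of_labelBT_horizon` VERBATIM (`e^{−κ₁(K + 1 − rootStep)}·treeWt (rhoH (Δ·e^{κ₁
D}) C g ∘ sh) …`: the horizon span is bounded by the merger-padded banks, the deficit `e^{κ₁ D}` sits on the root
weight as in `T4CountHorizon`).  §10 END TO END: `exists_relWeightBound_of_bankingTH` and
`exists_irThreshold_relWeightBound_canon_lateMergers` — the statements of
`T4CountHorizon.exists_relWeightBound_of_bankingT_horizon` / `…_canon_horizon` VERBATIM except the LABELLING BINDER,
which now asks at each counted record for SOME tagged genealogy `G′` with `ConsistentTH sh C K (R K) D G′` (renewals by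
the horizon; each merger partner pending OR overdue), `FreshT G′`, `K − D < reach G′`, `relabel (shape ∘ sh) G′ = G` and
the price clause with `lifeCost (padW (dictWT sh (R K) C.n₁) D) (costT sh C K (R K)) G′`; the threshold is part 3's;
the CONCLUSION — `∃ K₁ ≥ K₀, RelWeightBound …` with budget `𝟙·Cn·recordsBudget (Δ·e^{C.κ₁ D}·birthMass C) C.κ₁ V Λ η̄₊
j⋆`, rates, fixed point, event budgets, CONDITION `Λ·e^{η̄₊ − C.κ₁} < 1` — is UNCHANGED (so `T4CountHorizon` §5's
K-free threshold shift applies verbatim).  DISPLAYED CHANGES vs `T4CountHorizon`, in full: (i) `ConsistentTH` for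
`ConsistentT` (two clauses), (ii) `FreshT` for `WF` (WF over `padW` is derived), (iii) padded life cost in the price
clause, (iv) `x₀` raised K-freely through `HmH`; nothing else.  RENEWAL-SIDE INTERFACE (t4-ne7b-p2 INFO I-g18-1): lives
on `padW`, booking on TRUE windows, bank `bankW` (= true window, `+ D` on merger-shaped labels only).

ABSOLUTE RULE.  No internally-minted statement enters as a cited fact: 0 `[cite:]` tags, every hypothesis of every
theorem is a displayed binder; the manuscripts under audit (B15 = [Balaban1989LargeFieldI], B16 =
[Balaban1989LargeFieldII]; (1.79)–(1.89) pp. 383–387, (2.5)/(2.7)/(2.9) p. 361 of B14 = [Balaban1988RenormLattice])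
appear in docstrings as CONTEXT only, never as facts; programme-internal claims are not cited.  NOT PRINTED: [CONV-D],
the ledger, the banks and every inequality here are the cell's MODEL of print's procedure, handed to the (ID) owner
(GAPS G-ne7bp1g9-1) as the target of an identification nobody in the cell asserts.
-/

namespace Summit.QuantumFields.BalabanUV.T4Continuum.LateMergers

open Finset
open Literature.MathematicalPhysics.QuantumFieldTheory.Balaban1983to89
open T4PersistenceDictionary T4PersistentHistoryCount T4BankedInduction T4PrintedShapeBanking
open T4WeightBudget T4GlobalDenominator T4LiveClassFibration T4LiveStructureGas T4LiveGasToTerms T4RecordPriceSeam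
open T4PartnerMultiplicity T4BranchingRecordsGas T4TaggedShapeBanking T4CanonicalMenus T4CountHorizon

noncomputable section

/-! ## §9 The bridge from a span inequality; the seam with late mergers -/

section BridgeH

variable {ε : Type*} [DecidableEq ε]

/-- **THE GENERIC BRIDGE FROM A SPAN INEQUALITY** — `T4BranchingRecordsGas.treeShape_of_mulRawShape` with its two uses
of the schedule (`K < reach`, `partnerAges ≤ windowSurplus`) replaced by ONE displayed span inequality
`(N − rootStep) + partnerAges ≤ Σ_{events} W e` for the BANK table `W` (well-formedness, for any table `W′`, is used only
for label distinctness): a price `y ≤ M^{partnerAges}·(ρ root·e^{−κ₁ W root}·∏_{events ∖ root}(e^{−κ₁ W e}·η e))` obeys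
`y ≤ e^{−κ₁ (N − rootStep)}·treeWt ρ η (M·e^{−κ₁}) st G`. [folklore] -/
theorem treeShape_of_spanLE {W W' st : ε → ℕ} {ρ η : ε → ℝ} {κ₁ M : ℝ} (hκ : 0 ≤ κ₁) (hM : 0 ≤ M) {G : Gen ε}
    (hW : G.WF W') (hρ : 0 ≤ ρ G.root) (hη : ∀ e, 0 < η e) {N : ℕ}
    (hspan : (N - G.rootStep) + partnerAges st G ≤ ∑ e ∈ G.events, W e) {y : ℝ}
    (hy : y ≤ M ^ partnerAges st G * (ρ G.root * Real.exp (-(κ₁ * W G.root)) *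
      ∏ e ∈ G.events.erase G.root, (Real.exp (-(κ₁ * W e)) * η e))) :
    y ≤ Real.exp (-(κ₁ * ((N - G.rootStep : ℕ) : ℝ))) * treeWt ρ η (M * Real.exp (-κ₁)) st G := by
  have hP : ∏ e ∈ G.events.erase G.root, η e = npNR η G := (npNR_eq_prod_erase η W' hW (hη G.root).ne').symm
  have hP0 : 0 ≤ npNR η G := npNR_nonneg (fun e => (hη e).le) G
  have hraw : ρ G.root * Real.exp (-(κ₁ * W G.root)) * ∏ e ∈ G.events.erase G.root, (Real.exp (-(κ₁ * W e)) * η e)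
      = ρ G.root * Real.exp (-(κ₁ * ((∑ e ∈ G.events, W e : ℕ) : ℝ))) * npNR η G := by
    rw [Finset.prod_mul_distrib, hP, ← prod_expWindow_eq,
      ← Finset.mul_prod_erase G.events (fun e => Real.exp (-(κ₁ * (W e : ℝ)))) (Gen.root_mem G)]
    ring
  have hcast : ((N - G.rootStep : ℕ) : ℝ) + (partnerAges st G : ℝ) ≤ ((∑ e ∈ G.events, W e : ℕ) : ℝ) := by
    exact_mod_cast hspan
  have hexp : Real.exp (-(κ₁ * ((∑ e ∈ G.events, W e : ℕ) : ℝ))) ≤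
      Real.exp (-(κ₁ * ((N - G.rootStep : ℕ) : ℝ))) * Real.exp (-κ₁) ^ partnerAges st G := by
    rw [← Real.exp_nat_mul, ← Real.exp_add]
    exact Real.exp_le_exp.2 (by nlinarith [mul_le_mul_of_nonneg_left hcast hκ])
  calc y ≤ M ^ partnerAges st G * (ρ G.root * Real.exp (-(κ₁ * ((∑ e ∈ G.events, W e : ℕ) : ℝ))) * npNR η G) := by
        rw [← hraw]; exact hy
    _ ≤ M ^ partnerAges st G * (ρ G.root * (Real.exp (-(κ₁ * ((N - G.rootStep : ℕ) : ℝ))) *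
          Real.exp (-κ₁) ^ partnerAges st G) * npNR η G) :=
        mul_le_mul_of_nonneg_left (mul_le_mul_of_nonneg_right (mul_le_mul_of_nonneg_left hexp hρ) hP0)
          (pow_nonneg hM _)
    _ = Real.exp (-(κ₁ * ((N - G.rootStep : ℕ) : ℝ))) * treeWt ρ η (M * Real.exp (-κ₁)) st G := by
        rw [treeWt, mul_pow]; ring

variable {sh : ε → PEv} {C : T4PrintedShapeBanking.Consts} {K : ℕ} {R : ℕ → ℕ} {D : ℕ} {g : ℕ → ℝ}

/-- **EVERY CONSISTENT (LATE MERGERS ALLOWED), PADDED-WELL-FORMED TAGGED GENEALOGY OBEYS THE PRICE SHAPE with the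
merger-padded bank**: `e^{−credits}·e^{+lifeCost♯} ≤ (rho C g ∘ sh) root·e^{−κ₁ bankW root}·∏_{events ∖ root}
(e^{−κ₁ bankW e}·(eta C ∘ sh) e)` — `T4BankedInduction.rawFactor_le_recordPrice` by name. [folklore] -/
theorem rawFactor_le_shapeTH
    (B : Banking (ConsistentTH sh C K R D) (padW (dictWT sh R C.n₁) D) (costT sh C K R) (credit C g ∘ sh)
      (fun e => C.κ₁ * ((bankW sh R C.n₁ D e : ℕ) : ℝ) + Emarg C (sh e)) (reserve C g ∘ sh) (extnT sh C K R))
    {G : Gen ε} (hc : ConsistentTH sh C K R D G) (hW : G.WF (padW (dictWT sh R C.n₁) D)) :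
    Real.exp (-credits (credit C g ∘ sh) G) * Real.exp (lifeCost (padW (dictWT sh R C.n₁) D) (costT sh C K R) G) ≤
      (rho C g ∘ sh) G.root * Real.exp (-(C.κ₁ * ((bankW sh R C.n₁ D G.root : ℕ) : ℝ))) *
        ∏ e ∈ G.events.erase G.root,
          (Real.exp (-(C.κ₁ * ((bankW sh R C.n₁ D e : ℕ) : ℝ))) * (eta C ∘ sh) e) := by
  have hp := rawFactor_le_recordPrice B hc hW
  simpa only [Function.comp_apply, rho_eq, eta_eq] using hp

/-- **THE SEAM WITH LATE MERGERS, ONE TAGGED GENEALOGY**: if the late-merger data inhabit `Banking` at cutoff `K` along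
`(R, g)` with horizon `D`, `0 ≤ C.κ₁`, `0 ≤ Λ′`, `1 ≤ Δ`, then a price `y` that is either `≤ 0` or at most
`Δ·Λ′^{partnerAges}` × the raw factor (padded life cost) of a `ConsistentTH`, FRESH tagged genealogy `G` with
`K − D < reach G` obeys `y ≤ e^{−C.κ₁ (K + 1 − rootStep G)}·treeWt (rhoH (Δ·e^{C.κ₁ D}) C g ∘ sh) (eta C ∘ sh)
(Λ′e^{−C.κ₁}) (PEv.step ∘ sh) G` — the conclusion of `T4CountHorizon.treeShape_of_labelBT_horizon` VERBATIM.
[folklore] -/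
theorem treeShape_of_labelBTH (hκ : 0 ≤ C.κ₁)
    (hBk : Banking (ConsistentTH sh C K R D) (padW (dictWT sh R C.n₁) D) (costT sh C K R) (credit C g ∘ sh)
      (fun e => C.κ₁ * ((bankW sh R C.n₁ D e : ℕ) : ℝ) + Emarg C (sh e)) (reserve C g ∘ sh) (extnT sh C K R))
    {Λ' Δ : ℝ} (hΛ0 : 0 ≤ Λ') (hΔ : 1 ≤ Δ) {y : ℝ} {G : Gen ε}
    (hlab : y ≤ 0 ∨ (ConsistentTH sh C K R D G ∧ FreshT G ∧ K - D < G.reach (dictWT sh R C.n₁) ∧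
      y ≤ Δ * (Λ' ^ partnerAges (PEv.step ∘ sh) G *
        (Real.exp (-credits (credit C g ∘ sh) G) *
          Real.exp (lifeCost (padW (dictWT sh R C.n₁) D) (costT sh C K R) G))))) :
    y ≤ Real.exp (-(C.κ₁ * ((K + 1 - G.rootStep : ℕ) : ℝ))) *
      treeWt (rhoH (Δ * Real.exp (C.κ₁ * (D : ℝ))) C g ∘ sh) (eta C ∘ sh) (Λ' * Real.exp (-C.κ₁))
        (PEv.step ∘ sh) G := by
  have hΔ0 : 0 ≤ Δ := zero_le_one.trans hΔ
  have hΞ0 : 0 ≤ Δ * Real.exp (C.κ₁ * (D : ℝ)) := mul_nonneg hΔ0 (Real.exp_pos _).le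
  rcases hlab with h | ⟨hc, hF, hK, hy⟩
  · exact h.trans (mul_nonneg (Real.exp_pos _).le (treeWt_nonneg (fun b => rhoH_nonneg hΞ0 C g (sh b))
      (fun e => (eta_pos C (sh e)).le) (mul_nonneg hΛ0 (Real.exp_pos _).le) (PEv.step ∘ sh) G))
  · have hW := ConsistentTH.wf_padW hc hF
    have hraw := rawFactor_le_shapeTH hBk hc hW
    have hy' : y ≤ Λ' ^ partnerAges (PEv.step ∘ sh) G * ((rhoH Δ C g ∘ sh) G.root *
        Real.exp (-(C.κ₁ * ((bankW sh R C.n₁ D G.root : ℕ) : ℝ))) *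
        ∏ e ∈ G.events.erase G.root,
          (Real.exp (-(C.κ₁ * ((bankW sh R C.n₁ D e : ℕ) : ℝ))) * (eta C ∘ sh) e)) := by
      calc y ≤ Δ * (Λ' ^ partnerAges (PEv.step ∘ sh) G *
            (Real.exp (-credits (credit C g ∘ sh) G) *
              Real.exp (lifeCost (padW (dictWT sh R C.n₁) D) (costT sh C K R) G))) := hy
        _ ≤ Δ * (Λ' ^ partnerAges (PEv.step ∘ sh) G * ((rho C g ∘ sh) G.root *
            Real.exp (-(C.κ₁ * ((bankW sh R C.n₁ D G.root : ℕ) : ℝ))) *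
            ∏ e ∈ G.events.erase G.root,
              (Real.exp (-(C.κ₁ * ((bankW sh R C.n₁ D e : ℕ) : ℝ))) * (eta C ∘ sh) e))) :=
          mul_le_mul_of_nonneg_left (mul_le_mul_of_nonneg_left hraw (pow_nonneg hΛ0 _)) hΔ0
        _ = _ := by simp only [Function.comp_apply, rhoH_apply]; ring
    have h := treeShape_of_spanLE (ρ := rhoH Δ C g ∘ sh) (η := eta C ∘ sh) (st := PEv.step ∘ sh)
      (W := bankW sh R C.n₁ D) hκ hΛ0 hW (rhoH_nonneg hΔ0 C g (sh G.root)) (fun e => eta_pos C (sh e))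
      (ConsistentTH.horizonSpan_add_partnerAges_le hc hF hK) hy'
    have hT : 0 ≤ treeWt (rhoH Δ C g ∘ sh) (eta C ∘ sh) (Λ' * Real.exp (-C.κ₁)) (PEv.step ∘ sh) G :=
      treeWt_nonneg (fun b => rhoH_nonneg hΔ0 C g (sh b)) (fun e => (eta_pos C (sh e)).le)
        (mul_nonneg hΛ0 (Real.exp_pos _).le) (PEv.step ∘ sh) G
    calc y ≤ _ := h
      _ ≤ Real.exp (C.κ₁ * (D : ℝ)) * Real.exp (-(C.κ₁ * ((K + 1 - G.rootStep : ℕ) : ℝ))) *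
            treeWt (rhoH Δ C g ∘ sh) (eta C ∘ sh) (Λ' * Real.exp (-C.κ₁)) (PEv.step ∘ sh) G :=
          mul_le_mul_of_nonneg_right (exp_horizonSpan_le hκ K D G.rootStep) hT
      _ = _ := by rw [treeWt_rhoH_comp, treeWt_rhoH_comp]; ring

/-- **THE SEAM WITH LATE MERGERS, ONE BRANCHING SLOT**: the labelling binder at one slot — the price at the branching
record `G` (a genealogy term over SHAPES) is either `≤ 0` or at most `Δ·Λ′^{partnerAges G̃}` × the raw factor (padded
life cost) of SOME `ConsistentTH`, FRESH tagged genealogy `G̃ : Gen ε` with `K − D < reach G̃` whose shape-relabelling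
is `G`; then `y ≤ e^{−C.κ₁ (K + 1 − rootStep G)}·treeWt (rhoH (Δ·e^{C.κ₁ D}) C g) (eta C) (Λ′e^{−C.κ₁}) PEv.step G`.
[folklore] -/
theorem treeShape_of_labelTH (hκ : 0 ≤ C.κ₁)
    (hBk : Banking (ConsistentTH sh C K R D) (padW (dictWT sh R C.n₁) D) (costT sh C K R) (credit C g ∘ sh)
      (fun e => C.κ₁ * ((bankW sh R C.n₁ D e : ℕ) : ℝ) + Emarg C (sh e)) (reserve C g ∘ sh) (extnT sh C K R))
    {Λ' Δ : ℝ} (hΛ0 : 0 ≤ Λ') (hΔ : 1 ≤ Δ) {y : ℝ} {G : Gen PEv}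
    (hlabT : y ≤ 0 ∨ ∃ G' : Gen ε, ConsistentTH sh C K R D G' ∧ FreshT G' ∧
      K - D < G'.reach (dictWT sh R C.n₁) ∧ relabel (shape ∘ sh) G' = G ∧
      y ≤ Δ * (Λ' ^ partnerAges (PEv.step ∘ sh) G' *
        (Real.exp (-credits (credit C g ∘ sh) G') *
          Real.exp (lifeCost (padW (dictWT sh R C.n₁) D) (costT sh C K R) G')))) :
    y ≤ Real.exp (-(C.κ₁ * ((K + 1 - G.rootStep : ℕ) : ℝ))) *
      treeWt (rhoH (Δ * Real.exp (C.κ₁ * (D : ℝ))) C g) (eta C) (Λ' * Real.exp (-C.κ₁)) PEv.step G := by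
  have hΞ0 : 0 ≤ Δ * Real.exp (C.κ₁ * (D : ℝ)) := mul_nonneg (zero_le_one.trans hΔ) (Real.exp_pos _).le
  rcases hlabT with h | ⟨G', hc, hF, hK, hG, hy⟩
  · exact h.trans (mul_nonneg (Real.exp_pos _).le (treeWt_nonneg (fun b => rhoH_nonneg hΞ0 C g b)
      (fun e => (eta_pos C e).le) (mul_nonneg hΛ0 (Real.exp_pos _).le) PEv.step G))
  · have h := treeShape_of_labelBTH hκ hBk hΛ0 hΔ (Or.inr ⟨hc, hF, hK, hy⟩)
    rw [← hG, rootStep_relabel, treeWt_relabel_shapeH]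
    exact h

end BridgeH

/-! ## §10 End to end with late mergers: along a family of runs, and over the canonical menus -/

section EndToEndTH

variable {ε γ κ ι : Type*} [DecidableEq ε] [DecidableEq γ] [DecidableEq κ] {l₀ : ℝ} {K₀ : ℕ} {π : ℕ → ι → κ}
  {T : ℕ → Finset ι} {A A' : ℕ → ℝ → ι → ℝ} {Bad' : ℕ → ℝ → Finset κ} {dead dead' : ℕ → ℝ → ι → ℝ}
  {F Rf F' Rf' : ℕ → κ → ℝ} {nlow nup mlow mup : ℕ → ℝ → ℝ} {Cn : ℝ}

/-- **`Banking` OF THE LATE-MERGER DATA + PRICES LABELLED BY `ConsistentTH`, FRESH GENEALOGIES PENDING AT THE HORIZON +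
THE BRANCHING RECORDS GAS ⇒ THE WEIGHT SLOT, DEFICITED.**  `T4CountHorizon.exists_relWeightBound_of_bankingT_horizon`
VERBATIM except: `hBk` is the LATE-MERGER banking (`ConsistentTH`, padded lives, merger-padded bank) and the labelling
binder asks for `ConsistentTH sh C K (R K) D G′ ∧ FreshT G′` (instead of `ConsistentT … G′ ∧ G′.WF (dictWT …)`) with the
padded life cost in the raw factor; SAME conclusion `∃ K₁ ≥ K₀, RelWeightBound …` with budget
`𝟙·Cn·recordsBudget (Δ·e^{C.κ₁ D}·ρ̄) C.κ₁ V Λ η̄₊ j⋆`. [folklore] -/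
theorem exists_relWeightBound_of_bankingTH (sh : ε → PEv) {C : T4PrintedShapeBanking.Consts} (hκ : 0 ≤ C.κ₁)
    (R : ℕ → ℕ → ℕ) (g : ℕ → ℕ → ℝ) (D : ℕ)
    (hBk : ∀ K, K₀ ≤ K → Banking (ConsistentTH sh C K (R K) D) (padW (dictWT sh (R K) C.n₁) D) (costT sh C K (R K))
      (credit C (g K) ∘ sh) (fun e => C.κ₁ * ((bankW sh (R K) C.n₁ D e : ℕ) : ℝ) + Emarg C (sh e))
      (reserve C (g K) ∘ sh) (extnT sh C K (R K)))
    (Cell : ℕ → ℕ → Finset γ) {V Λ : ℝ} (hV : 0 ≤ V) (hΛ : 0 < Λ)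
    (hcell : ∀ K a, ((Cell K a).card : ℝ) ≤ V * Λ ^ a)
    (Lren Lmer Lpart Lroot : ℕ → ℕ → Finset PEv) (Ncap : ℕ → ℕ)
    (hst : ∀ K t, ∀ e ∈ Lmer K t, PEv.step e = t) {ρbar a μ ν ηplus : ℝ}
    (hρbar : ∀ K j, ∑ b ∈ Lroot K j, rho C (g K) b ≤ ρbar) (ha : ∀ K t, ∑ e ∈ Lren K t, eta C e ≤ a)
    (hμ : ∀ K t, ∑ e ∈ Lmer K t, eta C e ≤ μ) (hν : ∀ K s, ∑ b ∈ Lpart K s, eta C b ≤ ν) (hηplus : 0 ≤ ηplus)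
    (hr : Λ * Real.exp (ηplus - C.κ₁) < 1) {Λ' : ℝ} (hΛ0 : 0 ≤ Λ')
    (h1 : Λ' * Real.exp (-C.κ₁) * Real.exp ηplus < 1)
    (hx : (a + μ * ν * (Λ' * Real.exp (-C.κ₁) / (1 - Λ' * Real.exp (-C.κ₁) * Real.exp ηplus))) * Real.exp ηplus ≤
      Real.exp ηplus - 1)
    (jstar : ℕ → ℕ) (hj : ∀ K, jstar K ≤ K) {c : ℝ} (hc : 0 < c)
    (hfrac : ∀ K : ℕ, c * K ≤ ((K - jstar K : ℕ) : ℝ)) {Δ : ℝ} (hΔ : 1 ≤ Δ)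
    (y : ℕ → ℕ → γ → Gen PEv → ℝ)
    (hy0 : ∀ K, ∀ j ≤ K, ∀ z ∈ Cell K (K - j), ∀ G ∈ runFam Lren Lmer Lpart Lroot Ncap K j, 0 ≤ y K j z G)
    (hlabTH : ∀ K, K₀ ≤ K → ∀ j ≤ K, ∀ z ∈ Cell K (K - j), ∀ G ∈ runFam Lren Lmer Lpart Lroot Ncap K j,
      y K j z G ≤ 0 ∨ ∃ G' : Gen ε, ConsistentTH sh C K (R K) D G' ∧ FreshT G' ∧
        K - D < G'.reach (dictWT sh (R K) C.n₁) ∧ relabel (shape ∘ sh) G' = G ∧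
        y K j z G ≤ Δ * (Λ' ^ partnerAges (PEv.step ∘ sh) G' * (Real.exp (-credits (credit C (g K) ∘ sh) G') *
          Real.exp (lifeCost (padW (dictWT sh (R K) C.n₁) D) (costT sh C K (R K)) G'))))
    (str : ℕ → κ → Finset (BSlot γ PEv))
    (hinj : ∀ K t, |t| ≤ l₀ → K₀ ≤ K → Set.InjOn (str K) (Bad' K t))
    (hstr : ∀ K t, |t| ≤ l₀ → K₀ ≤ K → ∀ c ∈ Bad' K t,
      str K c ⊆ bliveSlots Cell (runFam Lren Lmer Lpart Lroot Ncap) K ∧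
        ∃ o ∈ boldSlots Cell (runFam Lren Lmer Lpart Lroot Ncap) jstar K, o ∈ str K c)
    (hA : Regeneration l₀ π T A Bad' dead F Rf nlow nup Cn K₀)
    (hA' : Regeneration l₀ π T A' Bad' dead' F' Rf' mlow mup Cn K₀)
    (hF : ∀ K t, |t| ≤ l₀ → K₀ ≤ K → ∀ c ∈ Bad' K t, F K c * Rf K c ≤ famWeight (bslotPrice (y K)) (str K c))
    (hF' : ∀ K t, |t| ≤ l₀ → K₀ ≤ K → ∀ c ∈ Bad' K t, F' K c * Rf' K c ≤ famWeight (bslotPrice (y K)) (str K c))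
    (hCn : 0 ≤ Cn) :
    ∃ K₁, K₀ ≤ K₁ ∧ RelWeightBound l₀ T A A' (fun K t => if K₁ ≤ K then badOfClass π T Bad' K t else ∅)
      (Set.indicator {K | K₁ ≤ K}
        (fun K => Cn * recordsBudget (Δ * Real.exp (C.κ₁ * (D : ℝ)) * ρbar) C.κ₁ V Λ ηplus jstar K)) := by
  have hΞ0 : 0 ≤ Δ * Real.exp (C.κ₁ * (D : ℝ)) := mul_nonneg (zero_le_one.trans hΔ) (Real.exp_pos _).le
  exact exists_relWeightBound_of_regeneration_branchingGasRun Cell hV hΛ hcell Lren Lmer Lpart Lroot Ncap PEv.step hst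
    (fun K => rhoH (Δ * Real.exp (C.κ₁ * (D : ℝ))) C (g K)) (fun _ => eta C)
    (fun K b => rhoH_nonneg hΞ0 C (g K) b) (fun _ e => (eta_pos C e).le)
    (fun K j => by
      rw [sum_rhoH]
      exact mul_le_mul_of_nonneg_left (hρbar K j) hΞ0)
    ha hμ hν (mul_nonneg hΛ0 (Real.exp_pos _).le) hηplus h1 hx hr jstar hj hc hfrac y hy0
    (fun K hK j hjK z hz G hG => by
      have h := treeShape_of_labelTH hκ (hBk K hK) hΛ0 hΔ (hlabTH K hK j hjK z hz G hG)
      rwa [rootStep_of_mem_fam (Lren := Lren K) (Lmer := Lmer K) (Lpart := Lpart K) (Ncap K) (Lroot K j) j K G hG]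
        at h)
    str hinj hstr hA hA' hF hF' hCn

/-- **END TO END OVER THE CANONICAL MENUS, UNDER [CONV-D], LATE MERGERS ADMITTED.**
`T4CountHorizon.exists_irThreshold_relWeightBound_canon_horizon` VERBATIM except the labelling binder, which now asks,
at each counted record, for SOME tagged genealogy `G′` with `ConsistentTH sh C K (R K) D G′` (renewals by the horizon;
a merger partner pending OR overdue), `FreshT G′` (labels new, partners' label sets disjoint), `K − D < reach G′`,
`relabel (shape ∘ sh) G′ = G`, and the price clause with the PADDED life cost
`lifeCost (padW (dictWT sh (R K) C.n₁) D) (costT sh C K (R K)) G′`; the threshold `x₀` is the late-merger one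
(`exists_irThresholdTH`, constants and `D`); the conclusion — budget `𝟙·Cn·recordsBudget (Δ·e^{C.κ₁ D}·birthMass C) C.κ₁
V Λ η̄₊ j⋆`, rates, fixed point, event budgets, CONDITION `Λ·e^{η̄₊ − C.κ₁} < 1` — is UNCHANGED. [folklore] -/
theorem exists_irThreshold_relWeightBound_canon_lateMergers (sh : ε → PEv) (C : T4PrintedShapeBanking.Consts)
    (hC : C.Valid) (ha₀ : 0 < C.a) (hA₀ : 0 < C.A₀) (hμ₀ : 0 < C.μ) {L r : ℕ} (hL : 1 ≤ L) {β₀ : ℝ} (hβ : 0 ≤ β₀)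
    (hrq : r * (C.q' + 1) < C.p₀)
    (Cell : ℕ → ℕ → Finset γ) {V Λ : ℝ} (hV : 0 ≤ V) (hΛ : 0 < Λ)
    (hcell : ∀ K a, ((Cell K a).card : ℝ) ≤ V * Λ ^ a) (Dcap Ncap : ℕ → ℕ)
    (jstar : ℕ → ℕ) (hj : ∀ K, jstar K ≤ K) {c : ℝ} (hc : 0 < c)
    (hfrac : ∀ K : ℕ, c * K ≤ ((K - jstar K : ℕ) : ℝ)) (D : ℕ) {Δ : ℝ} (hΔ : 1 ≤ Δ)
    (hA : Regeneration l₀ π T A Bad' dead F Rf nlow nup Cn K₀)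
    (hA' : Regeneration l₀ π T A' Bad' dead' F' Rf' mlow mup Cn K₀) (hCn : 0 ≤ Cn) :
    ∃ x₀ : ℝ, ∀ (R : ℕ → ℕ → ℕ) (g : ℕ → ℕ → ℝ) (β' : ℕ → ℝ),
      (∀ K, K₀ ≤ K → B14.FlowIneq27 (g K) (β' K) β₀ C.p₀ K) →
      (∀ K, K₀ ≤ K → B14FlowStep.FlowIneq29 (R K) (g K) L (β' K) β₀ K) →
      (∀ K, K₀ ≤ K → ∀ s, s ≤ K → B14.IsRj L r (g K s) (R K s)) →
      (∀ K, K₀ ≤ K → ∀ s, s ≤ K → 1 ≤ Real.log ((g K s) ^ 2)⁻¹) →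
      (∀ K, K₀ ≤ K → x₀ ≤ Real.log ((g K K) ^ 2)⁻¹) →
      (∀ K s, 0 ≤ p0Profile C.A₀ C.p₀ (g K s)) →
      ∀ {ηplus : ℝ}, 0 ≤ ηplus → Λ * Real.exp (ηplus - C.κ₁) < 1 →
      ∀ {Λ' : ℝ}, 0 ≤ Λ' → Λ' * Real.exp (-C.κ₁) * Real.exp ηplus < 1 →
      (Real.exp (-C.E₀) + Real.exp (-C.E₀) * birthMass C *
          (Λ' * Real.exp (-C.κ₁) / (1 - Λ' * Real.exp (-C.κ₁) * Real.exp ηplus))) * Real.exp ηplus ≤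
        Real.exp ηplus - 1 →
      ∀ (y : ℕ → ℕ → γ → Gen PEv → ℝ),
      (∀ K, ∀ j ≤ K, ∀ z ∈ Cell K (K - j), ∀ G ∈ canonFam Dcap Ncap K j, 0 ≤ y K j z G) →
      (∀ K, K₀ ≤ K → ∀ j ≤ K, ∀ z ∈ Cell K (K - j), ∀ G ∈ canonFam Dcap Ncap K j,
        y K j z G ≤ 0 ∨ ∃ G' : Gen ε, ConsistentTH sh C K (R K) D G' ∧ FreshT G' ∧
          K - D < G'.reach (dictWT sh (R K) C.n₁) ∧ relabel (shape ∘ sh) G' = G ∧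
          y K j z G ≤ Δ * (Λ' ^ partnerAges (PEv.step ∘ sh) G' * (Real.exp (-credits (credit C (g K) ∘ sh) G') *
            Real.exp (lifeCost (padW (dictWT sh (R K) C.n₁) D) (costT sh C K (R K)) G')))) →
      ∀ (str : ℕ → κ → Finset (BSlot γ PEv)),
      (∀ K t, |t| ≤ l₀ → K₀ ≤ K → Set.InjOn (str K) (Bad' K t)) →
      (∀ K t, |t| ≤ l₀ → K₀ ≤ K → ∀ c ∈ Bad' K t,
        str K c ⊆ bliveSlots Cell (canonFam Dcap Ncap) K ∧
          ∃ o ∈ boldSlots Cell (canonFam Dcap Ncap) jstar K, o ∈ str K c) →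
      (∀ K t, |t| ≤ l₀ → K₀ ≤ K → ∀ c ∈ Bad' K t, F K c * Rf K c ≤ famWeight (bslotPrice (y K)) (str K c)) →
      (∀ K t, |t| ≤ l₀ → K₀ ≤ K → ∀ c ∈ Bad' K t, F' K c * Rf' K c ≤ famWeight (bslotPrice (y K)) (str K c)) →
      ∃ K₁, K₀ ≤ K₁ ∧ RelWeightBound l₀ T A A' (fun K t => if K₁ ≤ K then badOfClass π T Bad' K t else ∅)
        (Set.indicator {K | K₁ ≤ K}
          (fun K => Cn * recordsBudget (Δ * Real.exp (C.κ₁ * (D : ℝ)) * birthMass C) C.κ₁ V Λ ηplus jstar K)) := by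
  obtain ⟨x₀, hx₀⟩ := exists_irThresholdTH sh C hC ha₀ hA₀ hL hβ hrq D
  refine ⟨x₀, ?_⟩
  intro R g β' h27 h29 hR hx1 hir hP ηplus hηplus hr Λ' hΛ0 h1 hx y hy0 hlabTH str hinj hstr hF hF'
  exact exists_relWeightBound_of_bankingTH sh hC.κ₁_nonneg R g D
    (fun K hK => hx₀ K (R K) (g K) (β' K) (h27 K hK) (h29 K hK) (hR K hK) (hx1 K hK) (hir K hK))
    Cell hV hΛ hcell (fun _ => menuRen) (fun _ => menuMer) (dictB Dcap) (dictB Dcap) Ncap (fun _ t => menuMer_step t)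
    (fun K j => sum_dictB_rho_le hμ₀ Dcap K j (hP K j)) (fun K t => (sum_menuRen_eta C t).le)
    (fun K t => (sum_menuMer_eta C t).le) (fun K s => sum_dictB_eta_le hμ₀ Dcap K s) hηplus hr hΛ0 h1 hx jstar hj hc
    hfrac hΔ y hy0 hlabTH str hinj hstr hA hA' hF hF' hCn

end EndToEndTH

end

end Summit.QuantumFields.BalabanUV.T4Continuum.LateMergers
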